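import Summits.AtomisticToContinuum.HydrodynamicLimit.Theorems.AprioriBounds.Negative.CriticalLambda
import Literature.Analysis.FluidPDE.HardSphereFlowJointMeasurable
import Literature.Analysis.FluidPDE.HardSphereTrajectoryMeasurable
import Literature.MathematicalPhysics.KineticTheory.HardSphereBBGKYLiouvilleFlow
import Literature.MathematicalPhysics.KineticTheory.HardSphereEulerProofs
import HarnessLib

/-!
# Component (i) of the a-priori crux from a fixed-time L¹ law of large numbers (stub `partOneChain`)

Supporting file of the line `Sketch` for the crux `AprioriBounds` (stmt-AtomisticToContinuum-14827;
`StiffCollisionalRelaxation.AprioriBounds` = `CollisionIsometryCLT.AprioriBoundsPreShock`), lead prover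
`prover-line-stmt-AtomisticToContinuum-14827-c1-0`, reshape r4 of `stub_partOne` (= component (i) verbatim):
(i) asks, with probability `→ 1`, a bound `C` on the TIME-AVERAGED empirical exponential velocity moment
`∫₀ᵗ G_N(Φ_s z) ds`, `G_N(w) = (N+1)⁻¹∑ᵢ e^{λ|vᵢ|²}`.  Since the threshold `C` is fixed while `N → ∞`, (i) is
tightness PLUS concentration; the natural fixed-time currency a producer delivers is an L¹ law of large numbers
along the flow: a bounded deterministic profile `g` on `[0, t]` with `sup_{s ≤ t} E_{P_N}|G_N(Φ_s ·) − g(s)| ≤ δ_N → 0`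
(`stub_partOneFixed`, open; at equilibrium `g ≡ E_{N(0,θ₀)}e^{λ|v|²}` and `δ_N = O((N+1)^{-1/2})`, landed in
`…EquilibriumStatics.lean` / `…EquilibriumPartOne.lean`).  This file proves the CHAINING `stub_partOneChain`: the
fixed-time L¹ statement implies (i) with `C = t·C₁ + 1`, for the local Gibbs laws of ANY continuous positive
profiles and ANY family of hard-sphere flows.

## Proof

On a good orbit `s ↦ G_N(Φ_s z)` is measurable (`IsHardSphereTrajectory.measurable_torus`) and bounded by
`e^{2λE(z)}` (energy conservation, `AprioriBoundsNegative.expAvg_le_exp_lam_energy`), so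
`∫₀ᵗ G_N(Φ_s z) ds ≤ ∫₀ᵗ |G_N(Φ_s z) − g(s)| ds + t·C₁`; the bad event therefore forces
`1 ≤ X(z) := ∫₀ᵗ |G_N(Φ_s z) − g(s)| ds` on the good set, which carries the law (`localGibbsLaw ≪ liouville`).
Markov and Tonelli — legitimate because `(z, s) ↦ (Φ_s z, s)` is jointly measurable on `good × ℝ`
(`HardSphereFlow.measurable_flow_prod_torus`; `aemeasurable_comp_flow_prod₂`) — give
`P_N(bad) ≤ E X = ∫₀ᵗ E|G_N∘Φ_s − g(s)| ds ≤ t·δ_N → 0`.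

No new definitions, no named facts; axioms `propext`, `Classical.choice`, `Quot.sound`.
-/

noncomputable section

open MeasureTheory Filter Set Topology
open scoped ENNReal

namespace Summit.AtomisticToContinuum.HydrodynamicLimit.Theorems.AdiabatCeiling

open Literature.MathematicalPhysics.KineticTheory Literature.Analysis.FluidPDE

/-- **Time-dependent observables composed with a hard-sphere flow are a.e.-jointly measurable** for every
law carried by the good set: for a measurable `F ≥ 0` on `phase space × ℝ`, a measure `P` with `P(goodᶜ) = 0`
and an s-finite `ν` on `ℝ`, `(z, s) ↦ F(Φ_s z, s)` is `P ⊗ ν`-a.e. measurable (on `good × ℝ` the flow is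
jointly measurable, `HardSphereFlow.measurable_flow_prod_torus`; extend by `0`). -/
theorem aemeasurable_comp_flow_prod₂ {ε : ℝ} {n : ℕ} (Φ : HardSphereFlow (Torus.geometry (Fin 3)) ε n)
    {F : Config n (Fin 3) T3 × ℝ → ℝ≥0∞} (hF : Measurable F) {P : Measure (Config n (Fin 3) T3)}
    (hP : P Φ.goodᶜ = 0) (ν : Measure ℝ) [SFinite ν] :
    AEMeasurable (fun p : Config n (Fin 3) T3 × ℝ => F (Φ.flow p.2 p.1, p.2)) (P.prod ν) := by
  classical
  set S : Set (Config n (Fin 3) T3 × ℝ) := Prod.fst ⁻¹' Φ.good with hS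
  have hSm : MeasurableSet S := Φ.measurableSet_good.preimage measurable_fst
  have hF' : Measurable fun q : Φ.good × ℝ => F (Φ.flow q.2 (q.1 : Config n (Fin 3) T3), q.2) :=
    hF.comp (Φ.measurable_flow_prod_torus.prodMk measurable_snd)
  have hι : Measurable fun p : S => ((⟨p.1.1, p.2⟩ : Φ.good), p.1.2) :=
    (measurable_subtype_coe.fst.subtype_mk).prodMk measurable_subtype_coe.snd
  refine ⟨fun p => if hp : p ∈ S then F (Φ.flow p.2 ((⟨p.1, hp⟩ : Φ.good) : Config n (Fin 3) T3), p.2)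
    else 0, Measurable.dite (hF'.comp hι) measurable_const hSm, ?_⟩
  have hae : ∀ᵐ p ∂(P.prod ν), p ∈ S := by
    rw [ae_iff]
    have hset : {p : Config n (Fin 3) T3 × ℝ | p ∉ S} = Φ.goodᶜ ×ˢ (univ : Set ℝ) := by
      ext p
      simp [hS]
    rw [hset, Measure.prod_prod, hP, zero_mul]
  filter_upwards [hae] with p hp
  rw [dif_pos hp]

/-- STUB `partOneChain` of the line `Sketch` (reshape r4; PROVED): **a fixed-time L¹ law of large numbers for
the empirical exponential moment along the flow implies component (i).**  For the local Gibbs laws of any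
continuous profiles `a₀, θ₀ > 0`, `u₀`, any `σ`, any family of hard-sphere flows `Φ`, `t > 0`, `λ ≥ 0`, a
measurable profile `g` with `|g| ≤ C₁` on `[0, t]` and a rate `δ_N → 0`: if
`E_{P_N}|(N+1)⁻¹∑ᵢ e^{λ|vᵢ(s)|²} − g(s)| ≤ δ_N` for every `N` and every `s ∈ [0, t]`, then
`P_N{t·C₁ + 1 < ∫₀ᵗ (N+1)⁻¹∑ᵢ e^{λ|vᵢ(s)|²} ds} → 0`. -/
theorem stub_partOneChain :
    ∀ (a₀ θ₀ : T3 → ℝ) (u₀ : T3 → V3), Continuous a₀ → Continuous θ₀ → Continuous u₀ →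
      (∀ x, 0 < a₀ x) → (∀ x, 0 < θ₀ x) →
      ∀ (σ : ℝ) (Φ : (N : ℕ) → HardSphereFlow (Torus.geometry (Fin 3)) (hsDiameter σ N) (N + 1))
        (t lam C₁ : ℝ) (g : ℝ → ℝ) (δ : ℕ → ℝ), 0 < t → 0 ≤ lam → Measurable g →
        (∀ s ∈ Icc 0 t, |g s| ≤ C₁) → Tendsto δ atTop (𝓝 0) →
        (∀ (N : ℕ), ∀ s ∈ Icc 0 t,
          ∫⁻ z, ENNReal.ofReal |(∫ y, Real.exp (lam * ‖y.2‖ ^ 2) ∂(empiricalMeasure ((Φ N).flow s z))) - g s|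
            ∂(localGibbsLaw σ a₀ u₀ θ₀ N (Φ N)) ≤ ENNReal.ofReal (δ N)) →
        Tendsto (fun N : ℕ => localGibbsLaw σ a₀ u₀ θ₀ N (Φ N)
          {z | t * C₁ + 1 < ∫ s in Icc 0 t, ∫ y, Real.exp (lam * ‖y.2‖ ^ 2)
            ∂(empiricalMeasure ((Φ N).flow s z))}) atTop (𝓝 0) := by
  intro a₀ θ₀ u₀ ha hθ hu ha0 hθ0 σ Φ t lam C₁ g δ ht hlam hgm hgC hδ hfix
  -- the empirical moment as a phase-space function
  set G : (N : ℕ) → Config (N + 1) (Fin 3) T3 → ℝ :=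
    fun N z => ((N + 1 : ℕ) : ℝ)⁻¹ * ∑ i, Real.exp (lam * ‖(z i).2‖ ^ 2) with hG
  have hGm : ∀ N, Measurable (G N) := fun N =>
    measurable_const.mul (Finset.measurable_sum _ fun i _ =>
      (measurable_pi_apply i).snd.norm.pow_const 2 |>.const_mul lam |>.exp)
  have hG0 : ∀ N z, 0 ≤ G N z := fun N z =>
    mul_nonneg (by positivity) (Finset.sum_nonneg fun i _ => (Real.exp_pos _).le)
  have hGemp : ∀ N (w : Config (N + 1) (Fin 3) T3),
      ∫ y, Real.exp (lam * ‖y.2‖ ^ 2) ∂(empiricalMeasure w) = G N w := fun N w => by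
    simp only [hG, integral_empiricalMeasure]
  -- the law: carried by the good set, finite
  have hgood0 : ∀ N, localGibbsLaw σ a₀ u₀ θ₀ N (Φ N) (Φ N).goodᶜ = 0 := fun N => by
    rw [localGibbsLaw_eq]
    exact (localGibbsMeasure_absolutelyContinuous σ _ _ _ N (Φ N)) (Φ N).measure_compl_good
  haveI hfin : ∀ N, IsFiniteMeasure (localGibbsLaw σ a₀ u₀ θ₀ N (Φ N)) := fun N => by
    rw [localGibbsLaw_eq]
    refine ⟨?_⟩
    rw [localGibbsMeasure_univ ha hθ hu (fun x => (ha0 x).le) hθ0 σ N]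
    exact ENNReal.mul_lt_top ENNReal.ofReal_lt_top ENNReal.ofReal_lt_top
  -- the bound for every `N`
  have hbound : ∀ N : ℕ, localGibbsLaw σ a₀ u₀ θ₀ N (Φ N)
      {z | t * C₁ + 1 < ∫ s in Icc 0 t, ∫ y, Real.exp (lam * ‖y.2‖ ^ 2)
        ∂(empiricalMeasure ((Φ N).flow s z))} ≤ ENNReal.ofReal (δ N) * ENNReal.ofReal t := by
    intro N
    set P : Measure (Config (N + 1) (Fin 3) T3) := localGibbsLaw σ a₀ u₀ θ₀ N (Φ N) with hP
    have hev : {z : Config (N + 1) (Fin 3) T3 | t * C₁ + 1 < ∫ s in Icc 0 t, ∫ y, Real.exp (lam * ‖y.2‖ ^ 2)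
        ∂(empiricalMeasure ((Φ N).flow s z))} = {z | t * C₁ + 1 < ∫ s in Icc 0 t, G N ((Φ N).flow s z)} := by
      ext z
      simp only [mem_setOf_eq, hGemp]
    rw [hev]
    set ν : Measure ℝ := volume.restrict (Icc 0 t) with hν
    have hνuniv : ν univ = ENNReal.ofReal t := by
      rw [hν, Measure.restrict_apply_univ, Real.volume_Icc, sub_zero]
    set X : Config (N + 1) (Fin 3) T3 → ℝ≥0∞ :=
      fun z => ∫⁻ s, ENNReal.ofReal |G N ((Φ N).flow s z) - g s| ∂ν with hX
    -- (1) on the good set the bad event forces `1 ≤ X`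
    have hincl : {z | t * C₁ + 1 < ∫ s in Icc 0 t, G N ((Φ N).flow s z)} ∩ (Φ N).good ⊆ {z | 1 ≤ X z} := by
      rintro z ⟨hz1, hz⟩
      simp only [mem_setOf_eq] at hz1 ⊢
      have horb : Measurable fun s => (Φ N).flow s z := ((Φ N).isTrajectory z hz).measurable_torus
      have hbdd : ∀ s, G N ((Φ N).flow s z) ≤ Real.exp (lam * (2 * configEnergy z)) := by
        intro s
        have h := AprioriBoundsNegative.expAvg_le_exp_lam_energy (N := N) hlam ((Φ N).flow s z)
        rw [(Φ N).configEnergy_flow hz s] at h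
        exact h
      have hGi : Integrable (fun s => G N ((Φ N).flow s z)) ν := by
        refine Measure.integrableOn_of_bounded (M := Real.exp (lam * (2 * configEnergy z)))
          measure_Icc_lt_top.ne ((hGm N).comp horb).aestronglyMeasurable (ae_of_all _ fun s => ?_)
        rw [Real.norm_eq_abs, abs_of_nonneg (hG0 N _)]
        exact hbdd s
      have hgi : Integrable g ν := by
        refine Measure.integrableOn_of_bounded (M := |C₁|) measure_Icc_lt_top.ne hgm.aestronglyMeasurable ?_
        rw [ae_restrict_iff' measurableSet_Icc]
        exact ae_of_all _ fun s hs => by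
          rw [Real.norm_eq_abs]
          exact (hgC s hs).trans (le_abs_self _)
      have hHi : Integrable (fun s => |G N ((Φ N).flow s z) - g s|) ν := (hGi.sub hgi).abs
      have hsplit : ∫ s, G N ((Φ N).flow s z) ∂ν = (∫ s, (G N ((Φ N).flow s z) - g s) ∂ν) + ∫ s, g s ∂ν := by
        rw [integral_sub hGi hgi]
        ring
      have hle1 : ∫ s, (G N ((Φ N).flow s z) - g s) ∂ν ≤ ∫ s, |G N ((Φ N).flow s z) - g s| ∂ν :=
        integral_mono (hGi.sub hgi) hHi fun s => le_abs_self _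
      have hle2 : ∫ s, g s ∂ν ≤ t * C₁ := by
        have h := norm_setIntegral_le_of_norm_le_const (μ := (volume : Measure ℝ)) (s := Icc 0 t) (f := g)
          (C := C₁) measure_Icc_lt_top fun s hs => by rw [Real.norm_eq_abs]; exact hgC s hs
        rw [Real.norm_eq_abs, Measure.real, Real.volume_Icc, sub_zero, ENNReal.toReal_ofReal ht.le] at h
        have h' : ∫ s in Icc 0 t, g s ≤ C₁ * t := (le_abs_self _).trans h
        rw [hν]
        linarith
      have h1 : 1 < ∫ s, |G N ((Φ N).flow s z) - g s| ∂ν := by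
        have : t * C₁ + 1 < (∫ s, (G N ((Φ N).flow s z) - g s) ∂ν) + ∫ s, g s ∂ν := by
          rw [← hsplit]; exact hz1
        linarith
      have hXz : X z = ENNReal.ofReal (∫ s, |G N ((Φ N).flow s z) - g s| ∂ν) := by
        rw [hX]
        exact (ofReal_integral_eq_lintegral_ofReal hHi (ae_of_all _ fun s => abs_nonneg _)).symm
      rw [hXz, ← ENNReal.ofReal_one]
      exact ENNReal.ofReal_le_ofReal h1.le
    -- (2) joint a.e.-measurability, Markov, Tonelli
    have hFm : Measurable fun p : Config (N + 1) (Fin 3) T3 × ℝ => ENNReal.ofReal |G N p.1 - g p.2| :=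
      (((hGm N).comp measurable_fst).sub (hgm.comp measurable_snd)).abs.ennreal_ofReal
    have hprod := aemeasurable_comp_flow_prod₂ (Φ N) hFm (hgood0 N) ν
    have hXm : AEMeasurable X P := hprod.lintegral_prod_right'
    have hPE : P {z | t * C₁ + 1 < ∫ s in Icc 0 t, G N ((Φ N).flow s z)} ≤ ∫⁻ z, X z ∂P := by
      calc P {z | t * C₁ + 1 < ∫ s in Icc 0 t, G N ((Φ N).flow s z)}
          ≤ P (({z | t * C₁ + 1 < ∫ s in Icc 0 t, G N ((Φ N).flow s z)} ∩ (Φ N).good) ∪ (Φ N).goodᶜ) :=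
            measure_mono fun z hz => by
              by_cases h : z ∈ (Φ N).good
              · exact Or.inl ⟨hz, h⟩
              · exact Or.inr h
        _ ≤ P ({z | t * C₁ + 1 < ∫ s in Icc 0 t, G N ((Φ N).flow s z)} ∩ (Φ N).good) + P (Φ N).goodᶜ :=
            measure_union_le _ _
        _ = P ({z | t * C₁ + 1 < ∫ s in Icc 0 t, G N ((Φ N).flow s z)} ∩ (Φ N).good) := by
            rw [hgood0 N, add_zero]
        _ ≤ P {z | 1 ≤ X z} := measure_mono hincl
        _ = 1 * P {z | 1 ≤ X z} := (one_mul _).symm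
        _ ≤ ∫⁻ z, X z ∂P := mul_meas_ge_le_lintegral₀ hXm 1
    have hTon : ∫⁻ z, X z ∂P ≤ ENNReal.ofReal (δ N) * ENNReal.ofReal t := by
      rw [hX, lintegral_lintegral_swap (f := fun z s => ENNReal.ofReal |G N ((Φ N).flow s z) - g s|) hprod]
      have hinner : ∀ᵐ s ∂ν, ∫⁻ z, ENNReal.ofReal |G N ((Φ N).flow s z) - g s| ∂P ≤ ENNReal.ofReal (δ N) := by
        rw [hν, ae_restrict_iff' measurableSet_Icc]
        refine ae_of_all _ fun s hs => ?_
        have h := hfix N s hs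
        simp only [hGemp] at h
        exact h
      calc ∫⁻ s, ∫⁻ z, ENNReal.ofReal |G N ((Φ N).flow s z) - g s| ∂P ∂ν
          ≤ ∫⁻ _s, ENNReal.ofReal (δ N) ∂ν := lintegral_mono_ae hinner
        _ = ENNReal.ofReal (δ N) * ENNReal.ofReal t := by rw [lintegral_const, hνuniv]
    exact hPE.trans hTon
  -- the bound tends to zero
  have hlim : Tendsto (fun N : ℕ => ENNReal.ofReal (δ N) * ENNReal.ofReal t) atTop (𝓝 0) := by
    have h0 : Tendsto (fun N : ℕ => ENNReal.ofReal (δ N)) atTop (𝓝 0) := by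
      have h := ENNReal.tendsto_ofReal hδ
      rwa [ENNReal.ofReal_zero] at h
    have h := ENNReal.Tendsto.mul_const (b := ENNReal.ofReal t) h0 (Or.inr ENNReal.ofReal_ne_top)
    rwa [zero_mul] at h
  exact tendsto_of_tendsto_of_tendsto_of_le_of_le tendsto_const_nhds hlim (fun _ => zero_le) hbound

end Summit.AtomisticToContinuum.HydrodynamicLimit.Theorems.AdiabatCeiling
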